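import Literature.NumberTheory.Sieve.SmoothCountLocal
import Mathlib.Data.Int.CardIntervalMod
import Mathlib.NumberTheory.Harmonic.Bounds
import HarnessLib

/-!
# Smooth numbers in a segment of an arithmetic progression (Friedlander's method; Harper's SNR3)

Topic `Literature/NumberTheory/Sieve`; a PROVED tool file toward
`Literature.NumberTheory.DiophantineGeometry.XYZUpperHalf` ([Harper2016, Cor. 1]). Harper's "Smooth
Numbers Result 3" (op. cit. §2.1, proved there from La Bretèche–Tenenbaum's local bound by "a
simple but powerful method of Friedlander"): for `log X ≤ y ≤ X`, `q ≥ 1`, `qy ≤ Z ≤ X`,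
`#{X ≤ n ≤ X + Z : n ≡ a (mod q), n ∈ S(y)} ≪ (Z/(qX)) Ψ(X, y) (Xq/Z)^{1−α(X,y)} log X`.

We PROVE a variant with the SAME method, in the form used downstream: the reference scale is a
fixed large `x` (with `α = α(x, y)`, `ζ̃ = ζ(α, y)/√φ₂(α, y)`, so that `Ψ(x', y) ≤ C x'^α ζ̃` for all
`x' ≤ x`, `card_smoothNumbersUpTo_le_model_of_le`), the residue class is arbitrary (no coprimality;
this costs a factor `τ(q) q^{1−α}`), and the segment `(V, V + Z]` is anywhere below `x`:

* `exists_divisor_mem_Ioc` — **Friedlander's factorisation**: a `y`-smooth `n > W ≥ 1` has a divisor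
  `m ∣ n` with `W < m ≤ W y` (reveal the prime factors one at a time).
* `card_Ioc_filter_mul_modEq_le` — `#{n' ∈ (A, B] : m n' ≡ c (mod q)} ≤ (B − A) gcd(m, q)/q + 1`
  (all solutions lie in one class modulo `q/gcd(m, q)`; Mathlib's `Nat.Ioc_filter_modEq_card`).
* `sum_inv_smooth_Ioc_le` — `∑_{U < m ≤ Uy, m ∈ S(y)} 1/m ≤ 4 C (log y/log 2 + 2) U^{α−1} ζ̃`
  (dyadic blocks and the local bound).
* `card_smooth_segment_modEq_le_of_coprime`, `card_smooth_segment_modEq_le` — **the segment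
  bound**: for `x ≥ x₀`, `(log x)^4 ≤ y`, `log y ≤ (log x)^{1/6}`, `q ≥ 1`, any `c`, `0 ≤ V`,
  `qy ≤ Z`, `V + Z ≤ x`:
  `#{n ∈ (V, V+Z] : n ≡ c (mod q), n ∈ S(y)} ≤ C log y · (Z/q)^α y^{1−α} ζ̃`
  (for `(c, q) = 1`: `n ≤ Z/(qy)` trivially; larger `n = m n'` with `Z/(qy) < m ≤ Z/q`, no `n'`
  unless `(m, q) = 1` and then at most `3Z/(mq)`; general `c`: divide by `h = (c, q)`).

## References

* A. J. Harper, Compositio Math. 152 (2016) 1121–1158, §2.1 "Smooth Numbers Result 3" and its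
  proof [Harper2016].
* J. B. Friedlander, *Integers free from large and small primes*, Proc. LMS 33 (1976) 565–576.
-/

noncomputable section

open Real Finset

namespace Literature.NumberTheory.Sieve

variable {x : ℝ} {y : ℕ}

/-! ### Friedlander's factorisation -/

/-- A list of naturals each `≤ y` (`y ≥ 1`) with product `> W ≥ 1` has a prefix whose product lies
in `(W, W y]`. [folklore] -/
theorem exists_prefix_prod_mem_Ioc {y : ℕ} {W : ℝ} (hW : 1 ≤ W) :
    ∀ l : List ℕ, (∀ p ∈ l, p ≤ y) → W < (l.prod : ℝ) →
      ∃ l₁ l₂ : List ℕ, l = l₁ ++ l₂ ∧ W < (l₁.prod : ℝ) ∧ (l₁.prod : ℝ) ≤ W * y := by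
  intro l
  induction l using List.reverseRecOn with
  | nil => intro _ h; simp at h; linarith
  | append_singleton l a ih =>
    intro hl hprod
    rw [List.prod_append, List.prod_singleton, Nat.cast_mul] at hprod
    have ha : a ≤ y := hl a (by simp)
    by_cases hsmall : (l.prod : ℝ) ≤ W
    · -- the whole list works
      refine ⟨l ++ [a], [], by simp, by simpa [List.prod_append] using hprod, ?_⟩
      rw [List.prod_append, List.prod_singleton, Nat.cast_mul]
      have ha' : (a : ℝ) ≤ y := by exact_mod_cast ha
      have h0 : (0 : ℝ) ≤ l.prod := Nat.cast_nonneg _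
      exact mul_le_mul hsmall ha' (Nat.cast_nonneg _) (by linarith)
    · push Not at hsmall
      obtain ⟨l₁, l₂, hl12, h1, h2⟩ := ih (fun p hp => hl p (by simp [hp])) hsmall
      exact ⟨l₁, l₂ ++ [a], by rw [hl12, List.append_assoc], h1, h2⟩

/-- **Friedlander's factorisation**: a `y`-smooth number `n > W` (`W ≥ 1`) has a divisor `m` with
`W < m ≤ W y`. [cite: Harper2016, §2.1 (proof of Smooth Numbers Result 3)] -/
theorem exists_divisor_mem_Ioc {n y : ℕ} {W : ℝ} (hW : 1 ≤ W) (hn : n ∈ Nat.smoothNumbers (y + 1))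
    (hnW : W < n) : ∃ m : ℕ, m ∣ n ∧ W < m ∧ (m : ℝ) ≤ W * y := by
  have hn0 : n ≠ 0 := hn.1
  have hl : ∀ p ∈ n.primeFactorsList, p ≤ y := fun p hp =>
    Nat.lt_succ_iff.mp (hn.2 p hp)
  have hprod : (n.primeFactorsList.prod : ℝ) = n := by
    exact_mod_cast Nat.prod_primeFactorsList hn0
  obtain ⟨l₁, l₂, hl12, h1, h2⟩ := exists_prefix_prod_mem_Ioc hW n.primeFactorsList hl (by rw [hprod]; exact hnW)
  refine ⟨l₁.prod, ?_, h1, h2⟩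
  have : l₁.prod ∣ n.primeFactorsList.prod := by
    rw [hl12, List.prod_append]; exact Dvd.intro _ rfl
  rwa [Nat.prod_primeFactorsList hn0] at this

/-! ### Counting in a residue class -/

/-- `#{n ∈ (a, b] : n ≡ v (mod r)} ≤ (b − a)/r + 1` (`0 < r`, `a ≤ b`). [folklore] -/
theorem card_Ioc_filter_modEq_le {a b r : ℕ} (hr : 0 < r) (hab : a ≤ b) (v : ℕ) :
    (#{n ∈ Ioc a b | n ≡ v [MOD r]} : ℝ) ≤ ((b : ℝ) - a) / r + 1 := by
  have h := Nat.Ioc_filter_modEq_card a b hr v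
  have h' : ((#{n ∈ Ioc a b | n ≡ v [MOD r]} : ℕ) : ℤ) =
      max (⌊((b : ℚ) - v) / r⌋ - ⌊((a : ℚ) - v) / r⌋) 0 := by exact_mod_cast h
  set A : ℤ := ⌊((b : ℚ) - v) / r⌋ with hAdef
  set B : ℤ := ⌊((a : ℚ) - v) / r⌋ with hBdef
  have hA : (A : ℚ) ≤ ((b : ℚ) - v) / r := Int.floor_le _
  have hB : ((a : ℚ) - v) / r - 1 < B := Int.sub_one_lt_floor _
  have hcardQ : ((#{n ∈ Ioc a b | n ≡ v [MOD r]} : ℕ) : ℚ) = ((max (A - B) 0 : ℤ) : ℚ) := by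
    exact_mod_cast h'
  have hr0 : (0 : ℚ) < r := by exact_mod_cast hr
  have hba : (0 : ℚ) ≤ ((b : ℚ) - a) / r :=
    div_nonneg (sub_nonneg.mpr (by exact_mod_cast hab)) hr0.le
  have key : ((#{n ∈ Ioc a b | n ≡ v [MOD r]} : ℕ) : ℚ) ≤ ((b : ℚ) - a) / r + 1 := by
    rw [hcardQ]
    rcases le_total (A - B) 0 with hle | hle
    · rw [max_eq_right hle]; push_cast; linarith
    · rw [max_eq_left hle]; push_cast
      have : ((b : ℚ) - v) / r - ((a : ℚ) - v) / r = ((b : ℚ) - a) / r := by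
        field_simp; ring
      linarith
  have key' := (Rat.cast_le (K := ℝ)).mpr key
  push_cast at key'
  exact key'

/-- **At most one solution per `q/gcd(m, q)` consecutive integers**:
`#{n' ∈ (A, B] : m n' ≡ c (mod q)} ≤ (B − A) gcd(m, q)/q + 1` (`q ≥ 1`, `A ≤ B`).
[cite: Harper2016, §2.1 (proof of Smooth Numbers Result 3)] -/
theorem card_Ioc_filter_mul_modEq_le {A B q : ℕ} (hq : 0 < q) (hAB : A ≤ B) (m c : ℕ) :
    (#{n' ∈ Ioc A B | m * n' ≡ c [MOD q]} : ℝ) ≤ ((B : ℝ) - A) * (Nat.gcd m q) / q + 1 := by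
  classical
  set S := {n' ∈ Ioc A B | m * n' ≡ c [MOD q]} with hS
  rcases S.eq_empty_or_nonempty with hemp | ⟨n₀, hn₀⟩
  · rw [hemp]; simp
    have : (0 : ℝ) ≤ ((B : ℝ) - A) * (Nat.gcd m q) / q :=
      div_nonneg (mul_nonneg (sub_nonneg.mpr (by exact_mod_cast hAB)) (Nat.cast_nonneg _)) (Nat.cast_nonneg _)
    linarith
  have hn₀' := (Finset.mem_filter.mp hn₀).2
  set g := Nat.gcd m q with hg
  have hg0 : 0 < g := Nat.gcd_pos_of_pos_right m hq
  have hgq : g ∣ q := Nat.gcd_dvd_right m q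
  set q' := q / g with hq'
  have hq'0 : 0 < q' := Nat.div_pos (Nat.le_of_dvd hq hgq) hg0
  have hsub : S ⊆ {n' ∈ Ioc A B | n' ≡ n₀ [MOD q']} := by
    intro n' hn'
    obtain ⟨hI, hmod⟩ := Finset.mem_filter.mp hn'
    refine Finset.mem_filter.mpr ⟨hI, ?_⟩
    have h1 : m * n' ≡ m * n₀ [MOD q] := hmod.trans hn₀'.symm
    have := Nat.ModEq.cancel_left_div_gcd hq h1
    rwa [Nat.gcd_comm] at this
  calc (#S : ℝ) ≤ #({n' ∈ Ioc A B | n' ≡ n₀ [MOD q']}) := by exact_mod_cast Finset.card_le_card hsub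
    _ ≤ ((B : ℝ) - A) / q' + 1 := card_Ioc_filter_modEq_le hq'0 hAB n₀
    _ = ((B : ℝ) - A) * g / q + 1 := by
        congr 1
        have hq'r : (q' : ℝ) = q / g := by
          rw [hq', Nat.cast_div hgq (by exact_mod_cast hg0.ne')]
        rw [hq'r, div_div_eq_mul_div]

/-! ### The harmonic sum over smooth numbers in `(U, Uy]` -/

/-- `α(x, y) < 1` in the range `(log x)^3 ≤ y ≤ x`, `log y ≤ (log x)^{1/6}`, `x ≥ x₀`
(from `y^{1-α} ≥ c u log(u+1)` with `u ≥ (log x)^{5/6} → ∞`). [cite: HildebrandTenenbaum1986, Lemma 2 (3.5)] -/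
theorem saddlePoint_lt_one :
    ∃ x₀ : ℝ, ∀ (x : ℝ) (y : ℕ), x₀ ≤ x → Real.log x ^ 3 ≤ y → (y : ℝ) ≤ x →
      Real.log y ≤ Real.log x ^ (1 / 6 : ℝ) → saddlePoint x y < 1 := by
  obtain ⟨c, x₂, hc, hB⟩ := le_rpow_one_sub_saddlePoint
  refine ⟨max x₂ (Real.exp (max 2 ((2 / c) ^ (6 / 5 : ℝ)))), fun x y hx hy3 hyx hy6 => ?_⟩
  have hx₂ : x₂ ≤ x := le_trans (le_max_left _ _) hx
  have hlogx : max 2 ((2 / c) ^ (6 / 5 : ℝ)) ≤ Real.log x := by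
    have := Real.log_le_log (Real.exp_pos _) (le_trans (le_max_right _ _) hx)
    rwa [Real.log_exp] at this
  have hL2 : 2 ≤ Real.log x := le_trans (le_max_left _ _) hlogx
  have hL0 : 0 < Real.log x := by linarith
  have hkey := hB x y hx₂ hy3 hyx
  have hy1 : (1 : ℝ) < y := by
    have : Real.log x ≤ y := by
      calc Real.log x = Real.log x * 1 * 1 := by ring
        _ ≤ Real.log x * Real.log x * Real.log x := by gcongr <;> linarith
        _ = Real.log x ^ 3 := by ring
        _ ≤ y := hy3
    linarith
  have hlogy : 0 < Real.log y := Real.log_pos hy1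
  set u := Real.log x / Real.log y with hu
  have hu56 : Real.log x ^ (5 / 6 : ℝ) ≤ u := by
    rw [hu, le_div_iff₀ hlogy]
    calc Real.log x ^ (5 / 6 : ℝ) * Real.log y ≤ Real.log x ^ (5 / 6 : ℝ) * Real.log x ^ (1 / 6 : ℝ) := by
          gcongr
      _ = Real.log x := by rw [← Real.rpow_add hL0]; norm_num
  have h2c : 2 / c ≤ u := by
    have h1 : (2 / c) ^ (6 / 5 : ℝ) ≤ Real.log x := le_trans (le_max_right _ _) hlogx
    calc 2 / c = ((2 / c) ^ (6 / 5 : ℝ)) ^ (5 / 6 : ℝ) := by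
          rw [← Real.rpow_mul (by positivity)]; norm_num
      _ ≤ Real.log x ^ (5 / 6 : ℝ) := Real.rpow_le_rpow (by positivity) h1 (by norm_num)
      _ ≤ u := hu56
  have hu0 : 0 < u := lt_of_lt_of_le (by positivity) h2c
  have hlog2 : (1 : ℝ) / 2 < Real.log (u + 1) := by
    have h1 : Real.log 2 ≤ Real.log (u + 1) := Real.log_le_log (by norm_num) (by
      have : 1 ≤ u := le_trans (by
        have : (1 : ℝ) ≤ Real.log x ^ (5 / 6 : ℝ) := Real.one_le_rpow (by linarith) (by norm_num)
        exact this) hu56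
      linarith)
    have := Real.log_two_gt_d9; linarith
  have hcu : 1 < c * (u * Real.log (u + 1)) := by
    have h1 : c * u * (1 / 2) < c * u * Real.log (u + 1) := mul_lt_mul_of_pos_left hlog2 (by positivity)
    have h2 : 1 ≤ c * u * (1 / 2) := by
      have := mul_le_mul_of_nonneg_left h2c hc.le
      rw [mul_div_cancel₀ _ hc.ne'] at this
      linarith
    calc (1 : ℝ) ≤ c * u * (1 / 2) := h2
      _ < c * u * Real.log (u + 1) := h1
      _ = c * (u * Real.log (u + 1)) := by ring
  by_contra hge
  push Not at hge
  have : (y : ℝ) ^ (1 - saddlePoint x y) ≤ 1 :=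
    Real.rpow_le_one_of_one_le_of_nonpos hy1.le (by linarith)
  linarith

/-! ### Small combinatorial tools -/

/-- A cover bound: if every element of `E` is related to some `m ∈ M`, then
`#E ≤ ∑_{m ∈ M} #{n ∈ E | P m n}`. [folklore] -/
theorem card_le_sum_card_filter {β γ : Type*} (E : Finset β) (M : Finset γ) (P : γ → β → Prop)
    [∀ m n, Decidable (P m n)] (h : ∀ n ∈ E, ∃ m ∈ M, P m n) :
    (E.card : ℝ) ≤ ∑ m ∈ M, ((E.filter (P m)).card : ℝ) := by
  classical
  have h1 : (E.card : ℝ) = ∑ n ∈ E, (1 : ℝ) := by simp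
  have h2 : ∀ n ∈ E, (1 : ℝ) ≤ ∑ m ∈ M, (if P m n then (1 : ℝ) else 0) := by
    intro n hn
    obtain ⟨m, hm, hP⟩ := h n hn
    calc (1 : ℝ) = (if P m n then (1 : ℝ) else 0) := by rw [if_pos hP]
      _ ≤ ∑ m ∈ M, (if P m n then (1 : ℝ) else 0) :=
          Finset.single_le_sum (f := fun m => if P m n then (1 : ℝ) else 0)
            (fun m _ => by positivity) hm
  rw [h1]
  refine (Finset.sum_le_sum h2).trans ?_
  rw [Finset.sum_comm]
  refine le_of_eq (Finset.sum_congr rfl fun m _ => ?_)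
  simp [Finset.sum_boole]

/-! ### The harmonic sum over smooth numbers in `(U, Uy]` -/

/-- **`∑_{U < m ≤ Uy, m ∈ S(y)} 1/m ≤ 4 B (log y/log 2 + 2) U^{α−1}`** when `Ψ(x', y) ≤ B x'^α` for all
`1 ≤ x' ≤ X`, `0 < α ≤ 1`, `0 < U`, `U y ≤ X`, `y ≥ 2` and `B ≥ 1 + log y` (dyadic blocks
`[u₀ 2^i, u₀ 2^{i+1})`, `u₀ = ⌊U⌋ + 1`, for `U ≥ 1`; the crude harmonic bound for `U < 1`).
[cite: Harper2016, §2.1 (proof of Smooth Numbers Result 3)] -/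
theorem sum_inv_smooth_Ioc_le {X B α U : ℝ} {y : ℕ} (hy : 2 ≤ y) (hα0 : 0 < α) (hα1 : α ≤ 1)
    (hU : 0 < U) (hUX : U * y ≤ X) (hB : 1 + Real.log y ≤ B)
    (hΨ : ∀ x' : ℝ, 1 ≤ x' → x' ≤ X → (#(Nat.smoothNumbersUpTo ⌊x'⌋₊ (y + 1)) : ℝ) ≤ B * x' ^ α) :
    ∑ m ∈ (Finset.Ioc ⌊U⌋₊ ⌊U * y⌋₊).filter (· ∈ Nat.smoothNumbers (y + 1)), (1 / (m : ℝ)) ≤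
      4 * B * (Real.log y / Real.log 2 + 2) * U ^ (α - 1) := by
  classical
  have hy1 : (1 : ℝ) < y := by exact_mod_cast (lt_of_lt_of_le one_lt_two hy)
  have hy0 : (0 : ℝ) < y := by linarith
  have hlogy : 0 ≤ Real.log y := Real.log_nonneg hy1.le
  have hB0 : 0 ≤ B := le_trans (by positivity) hB
  have hlog2 : 0 < Real.log 2 := Real.log_pos one_lt_two
  have hIy : (Nat.log 2 y : ℝ) ≤ Real.log y / Real.log 2 := by
    rw [le_div_iff₀ hlog2, ← Real.log_pow]
    exact Real.log_le_log (by positivity) (by exact_mod_cast Nat.pow_log_le_self 2 (by omega))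
  set S := (Finset.Ioc ⌊U⌋₊ ⌊U * y⌋₊).filter (· ∈ Nat.smoothNumbers (y + 1)) with hS
  have hSmem : ∀ m ∈ S, U < m ∧ (m : ℝ) ≤ U * y ∧ m ∈ Nat.smoothNumbers (y + 1) := by
    intro m hm
    rw [hS, Finset.mem_filter, Finset.mem_Ioc] at hm
    refine ⟨Nat.lt_of_floor_lt hm.1.1, ?_, hm.2⟩
    exact le_trans (by exact_mod_cast hm.1.2) (Nat.floor_le (by positivity))
  rcases lt_or_ge U 1 with hU1 | hU1
  · -- `U < 1`: crude bound `∑_{m ≤ y} 1/m ≤ 1 + log y ≤ B ≤ 4B(…)U^{α-1}`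
    have h1 : ∑ m ∈ S, (1 / (m : ℝ)) ≤ ∑ m ∈ Finset.Icc 1 y, (1 / (m : ℝ)) := by
      refine Finset.sum_le_sum_of_subset_of_nonneg (fun m hm => ?_) (fun m _ _ => by positivity)
      obtain ⟨hmU, hmUy, hsm⟩ := hSmem m hm
      rw [Finset.mem_Icc]
      refine ⟨Nat.pos_of_ne_zero hsm.1, ?_⟩
      have : (m : ℝ) ≤ y := by nlinarith
      exact_mod_cast this
    have h2 : ∑ m ∈ Finset.Icc 1 y, (1 / (m : ℝ)) ≤ 1 + Real.log y := by
      have := harmonic_le_one_add_log y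
      rw [harmonic_eq_sum_Icc] at this
      push_cast at this
      simpa [one_div] using this
    have hU' : (1 : ℝ) ≤ U ^ (α - 1) := Real.one_le_rpow_of_pos_of_le_one_of_nonpos hU hU1.le (by linarith)
    calc ∑ m ∈ S, (1 / (m : ℝ)) ≤ B := (h1.trans h2).trans hB
      _ = 1 * B * 1 * 1 := by ring
      _ ≤ 4 * B * (Real.log y / Real.log 2 + 2) * U ^ (α - 1) := by
          gcongr
          · norm_num
          · have : 0 ≤ Real.log y / Real.log 2 := by positivity
            linarith
  · -- `U ≥ 1`: dyadic blocks
    set u₀ : ℕ := ⌊U⌋₊ + 1 with hu₀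
    have hu₀U : U < u₀ := by rw [hu₀]; push_cast; exact Nat.lt_floor_add_one U
    have hu₀2U : (u₀ : ℝ) ≤ 2 * U := by
      rw [hu₀]; push_cast; linarith [Nat.floor_le hU.le]
    have hu₀0 : 0 < u₀ := by rw [hu₀]; omega
    set I : ℕ := Nat.log 2 y with hI
    set g : ℕ → ℕ := fun m => Nat.log 2 (m / u₀) with hg
    have hmaps : ∀ m ∈ S, g m ∈ Finset.range (I + 1) := by
      intro m hm
      obtain ⟨hmU, hmUy, -⟩ := hSmem m hm
      rw [Finset.mem_range, Nat.lt_succ_iff, hg, hI]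
      apply Nat.log_mono_right
      have : m / u₀ < y := by
        rw [Nat.div_lt_iff_lt_mul hu₀0]
        have : (m : ℝ) < y * u₀ := by nlinarith
        exact_mod_cast this
      exact this.le
    rw [← Finset.sum_fiberwise_of_maps_to hmaps]
    -- each block
    have hblock : ∀ i ∈ Finset.range (I + 1),
        ∑ m ∈ S.filter (fun m => g m = i), (1 / (m : ℝ)) ≤ 4 * B * U ^ (α - 1) := by
      intro i _
      set Si := S.filter (fun m => g m = i) with hSi
      -- members of block `i` satisfy `u₀ 2^i ≤ m < u₀ 2^{i+1}`
      have hmem : ∀ m ∈ Si, (u₀ : ℝ) * 2 ^ i ≤ m ∧ (m : ℝ) < u₀ * 2 ^ (i + 1) ∧ m ∈ S := by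
        intro m hm
        rw [hSi, Finset.mem_filter] at hm
        obtain ⟨hmS, hgi⟩ := hm
        obtain ⟨hmU, -, -⟩ := hSmem m hmS
        have hmu₀ : u₀ ≤ m := by
          have : (⌊U⌋₊ : ℝ) < m := lt_of_le_of_lt (Nat.floor_le hU.le) hmU
          have : ⌊U⌋₊ < m := by exact_mod_cast this
          rw [hu₀]; omega
        have h1 : 2 ^ i ≤ m / u₀ := by
          rw [← hgi, hg]; exact Nat.pow_log_le_self 2 (Nat.div_pos hmu₀ hu₀0).ne'
        have h2 : m / u₀ < 2 ^ (i + 1) := by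
          rw [← hgi, hg]; exact Nat.lt_pow_succ_log_self one_lt_two _
        refine ⟨?_, ?_, hmS⟩
        · have : u₀ * 2 ^ i ≤ m := by
            calc u₀ * 2 ^ i ≤ u₀ * (m / u₀) := Nat.mul_le_mul_left _ h1
              _ ≤ m := Nat.mul_div_le m u₀
          exact_mod_cast this
        · have : m < u₀ * 2 ^ (i + 1) := by
            calc m < u₀ * (m / u₀ + 1) := by
                  have := Nat.lt_div_mul_add (a := m) hu₀0
                  linarith [Nat.div_add_mod m u₀, Nat.mod_lt m hu₀0]
              _ ≤ u₀ * 2 ^ (i + 1) := Nat.mul_le_mul_left _ h2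
          exact_mod_cast this
      -- `1/m ≤ 1/(U 2^i)` on the block
      have hinv : ∀ m ∈ Si, (1 / (m : ℝ)) ≤ 1 / (U * 2 ^ i) := by
        intro m hm
        obtain ⟨h1, -, -⟩ := hmem m hm
        apply one_div_le_one_div_of_le (by positivity)
        calc U * 2 ^ i ≤ u₀ * 2 ^ i := by gcongr
          _ ≤ m := h1
      -- the block lies in `smoothNumbersUpTo ⌊x'⌋` with `x' = min(u₀ 2^{i+1}, U y)`
      set x' : ℝ := min ((u₀ : ℝ) * 2 ^ (i + 1)) (U * y) with hx'
      have hx'1 : 1 ≤ x' := by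
        rw [hx']; apply le_min
        · have : (1 : ℝ) ≤ u₀ := by exact_mod_cast hu₀0
          have : (1 : ℝ) ≤ 2 ^ (i + 1) := one_le_pow₀ (by norm_num)
          nlinarith
        · nlinarith
      have hx'X : x' ≤ X := le_trans (min_le_right _ _) hUX
      have hsub : Si ⊆ Nat.smoothNumbersUpTo ⌊x'⌋₊ (y + 1) := by
        intro m hm
        obtain ⟨-, h2, hmS⟩ := hmem m hm
        obtain ⟨-, hmUy, hsm⟩ := hSmem m hmS
        rw [Nat.mem_smoothNumbersUpTo]
        refine ⟨Nat.le_floor ?_, hsm⟩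
        rw [hx']; exact le_min h2.le hmUy
      have hcard : (Si.card : ℝ) ≤ B * x' ^ α :=
        le_trans (by exact_mod_cast Finset.card_le_card hsub) (hΨ x' hx'1 hx'X)
      have hx'pow : x' ^ α ≤ 4 * (U * 2 ^ i) ^ α := by
        have h1 : x' ≤ 4 * (U * 2 ^ i) := by
          calc x' ≤ (u₀ : ℝ) * 2 ^ (i + 1) := min_le_left _ _
            _ ≤ (2 * U) * 2 ^ (i + 1) := by gcongr
            _ = 4 * (U * 2 ^ i) := by rw [pow_succ]; ring
        calc x' ^ α ≤ (4 * (U * 2 ^ i)) ^ α := Real.rpow_le_rpow (by linarith) h1 hα0.le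
          _ = 4 ^ α * (U * 2 ^ i) ^ α := Real.mul_rpow (by norm_num) (by positivity)
          _ ≤ 4 ^ (1 : ℝ) * (U * 2 ^ i) ^ α :=
              mul_le_mul_of_nonneg_right (Real.rpow_le_rpow_of_exponent_le (by norm_num) hα1)
                (by positivity)
          _ = 4 * (U * 2 ^ i) ^ α := by rw [Real.rpow_one]
      calc ∑ m ∈ Si, (1 / (m : ℝ)) ≤ ∑ m ∈ Si, (1 / (U * 2 ^ i)) := Finset.sum_le_sum hinv
        _ = Si.card * (1 / (U * 2 ^ i)) := by rw [Finset.sum_const, nsmul_eq_mul]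
        _ ≤ (B * x' ^ α) * (1 / (U * 2 ^ i)) := mul_le_mul_of_nonneg_right hcard (by positivity)
        _ ≤ (B * (4 * (U * 2 ^ i) ^ α)) * (1 / (U * 2 ^ i)) := by gcongr
        _ = 4 * B * ((U * 2 ^ i) ^ α / (U * 2 ^ i)) := by ring
        _ = 4 * B * (U * 2 ^ i) ^ (α - 1) := by
            rw [Real.rpow_sub_one (by positivity)]
        _ ≤ 4 * B * U ^ (α - 1) := by
            apply mul_le_mul_of_nonneg_left _ (by positivity)
            rw [Real.mul_rpow hU.le (by positivity)]
            have : ((2 : ℝ) ^ i) ^ (α - 1) ≤ 1 :=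
              Real.rpow_le_one_of_one_le_of_nonpos (one_le_pow₀ (by norm_num)) (by linarith)
            have h0 : 0 ≤ U ^ (α - 1) := Real.rpow_nonneg hU.le _
            nlinarith
    calc ∑ i ∈ Finset.range (I + 1), ∑ m ∈ S.filter (fun m => g m = i), (1 / (m : ℝ))
        ≤ ∑ i ∈ Finset.range (I + 1), 4 * B * U ^ (α - 1) := Finset.sum_le_sum hblock
      _ = ((I : ℝ) + 1) * (4 * B * U ^ (α - 1)) := by
          rw [Finset.sum_const, Finset.card_range, nsmul_eq_mul]; push_cast; ring
      _ ≤ (Real.log y / Real.log 2 + 2) * (4 * B * U ^ (α - 1)) := by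
          apply mul_le_mul_of_nonneg_right _ (by positivity)
          linarith
      _ = 4 * B * (Real.log y / Real.log 2 + 2) * U ^ (α - 1) := by ring

/-! ### The segment bound -/

set_option maxHeartbeats 3000000 in
-- a long assembly with a large context
/-- **Smooth numbers in a segment of a reduced arithmetic progression** (Harper's Smooth Numbers
Result 3, Friedlander's method; reference scale `x`). For `x ≥ x₀`, `(log x)^4 ≤ y`,
`log y ≤ (log x)^{1/6}`, `q ≥ 1`, `(c, q) = 1`, and a segment `(V, V + Z]` with `0 ≤ V`, `qy ≤ Z`,
`V + Z ≤ x`: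
`#{n ∈ (V, V+Z] : n ≡ c (mod q), n ∈ S(y)} ≤ C log y · (Z/q)^α y^{1−α} ζ(α,y)/√φ₂(α,y)`,
`α = α(x, y)` (printed, at reference scale `X`: `≪ (Z/(qX)) Ψ(X,y) (Xq/Z)^{1−α} log X`; here
`Ψ(X, y) ≍ X^α ζ/√φ₂`). [cite: Harper2016, §2.1 (Smooth Numbers Result 3 and its proof)] -/
theorem card_smooth_segment_modEq_le_of_coprime :
    ∃ C x₀ : ℝ, 0 < C ∧ ∀ (x : ℝ) (y : ℕ), x₀ ≤ x → Real.log x ^ 4 ≤ y →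
      Real.log y ≤ Real.log x ^ (1 / 6 : ℝ) → ∀ (q : ℕ), 0 < q → ∀ (c : ℕ), Nat.Coprime c q →
        ∀ (V Z : ℝ), 0 ≤ V → (q : ℝ) * y ≤ Z → V + Z ≤ x →
        (#{n ∈ Finset.Ioc ⌊V⌋₊ ⌊V + Z⌋₊ | n ≡ c [MOD q] ∧ n ∈ Nat.smoothNumbers (y + 1)} : ℝ) ≤
          C * Real.log y * (Z / q) ^ saddlePoint x y * (y : ℝ) ^ (1 - saddlePoint x y) *
            (smoothZeta (saddlePoint x y) y / Real.sqrt (saddlePhi₂ (saddlePoint x y) y)) := by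
  classical
  obtain ⟨C₂, x₀M, hC₂, hM⟩ := card_smoothNumbersUpTo_le_model_of_le
  obtain ⟨x₀U, hU⟩ := saddlePhi₂_saddlePoint_le
  obtain ⟨x₀T, h35⟩ := three_fifths_le_saddlePoint
  obtain ⟨x₀1, hlt1⟩ := saddlePoint_lt_one
  obtain ⟨Y, hY1, hY⟩ := exists_log_le_mul_rpow (κ := 1) (ε := 1 / 2) one_pos (by norm_num)
  set C₂' : ℝ := max C₂ 1 with hC₂'
  have hC₂'1 : 1 ≤ C₂' := le_max_right _ _
  have hC₂'C : C₂ ≤ C₂' := le_max_left _ _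
  set X : ℝ := max (max x₀M x₀U) (max x₀T x₀1) with hXdef
  have hX_M : x₀M ≤ X := le_trans (le_max_left _ _) (le_max_left _ _)
  have hX_U : x₀U ≤ X := le_trans (le_max_right _ _) (le_max_left _ _)
  have hX_T : x₀T ≤ X := le_trans (le_max_left _ _) (le_max_right _ _)
  have hX_1 : x₀1 ≤ X := le_trans (le_max_right _ _) (le_max_right _ _)
  set L₀ : ℝ := max (max Y 256) 64 with hL₀
  refine ⟨25 * C₂', max X (Real.exp L₀), by positivity, fun x y hx hy4 hy6 q hq c hcq V Z hV hZ hVZ => ?_⟩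
  ------------------------------------------------------------------
  -- ### the range
  have hxX : X ≤ x := le_trans (le_max_left _ _) hx
  set L : ℝ := Real.log x with hLdef
  have hLL₀ : L₀ ≤ L := by
    have := Real.log_le_log (Real.exp_pos _) (le_trans (le_max_right _ _) hx)
    rwa [Real.log_exp] at this
  have hLY : Y ≤ L := le_trans ((le_max_left _ _).trans (le_max_left _ _)) hLL₀
  have hL256 : 256 ≤ L := le_trans ((le_max_right _ _).trans (le_max_left _ _)) hLL₀
  have hL64 : 64 ≤ L := le_trans (le_max_right _ _) hLL₀
  have hL1 : 1 ≤ L := by linarith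
  have hL0 : 0 < L := by linarith
  have hx1 : 1 < x := by
    have h64 : (64 : ℝ) ≤ L₀ := le_max_right _ _
    have h1 : (1 : ℝ) < Real.exp L₀ := by
      have : (1 : ℝ) < Real.exp 64 := by
        have := Real.add_one_le_exp (64 : ℝ); linarith
      exact lt_of_lt_of_le this (Real.exp_le_exp.mpr h64)
    exact lt_of_lt_of_le h1 (le_trans (le_max_right _ _) hx)
  have hx0 : 0 < x := by linarith
  have hy_ge : L ^ 4 ≤ y := hy4
  have hyL : L ≤ y := by
    calc L = L ^ 1 := (pow_one L).symm
      _ ≤ L ^ 4 := pow_le_pow_right₀ hL1 (by norm_num)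
      _ ≤ y := hy_ge
  have hy2r : (2 : ℝ) ≤ y := by linarith
  have hy2 : 2 ≤ y := by exact_mod_cast hy2r
  have hy0 : (0 : ℝ) < y := by linarith
  have hy1 : (1 : ℝ) ≤ y := by linarith
  set ℓ : ℝ := Real.log y with hℓdef
  have hℓ4L : 4 * Real.log L ≤ ℓ := by
    have := Real.log_le_log (by positivity) hy_ge
    rwa [Real.log_pow, Nat.cast_ofNat] at this
  have hlog64 : 4 ≤ Real.log 64 := by
    rw [show (64 : ℝ) = 2 ^ 6 by norm_num, Real.log_pow, Nat.cast_ofNat]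
    have := Real.log_two_gt_d9
    linarith
  have hlogL4 : 4 ≤ Real.log L := le_trans hlog64 (Real.log_le_log (by norm_num) hL64)
  have hℓ16 : 16 ≤ ℓ := by linarith
  have hℓ1 : 1 ≤ ℓ := by linarith
  have hℓ0 : 0 < ℓ := by linarith
  have hℓL6 : ℓ ≤ L ^ (1 / 6 : ℝ) := hy6
  have hL16 : L ^ (1 / 6 : ℝ) ≤ L := by
    calc L ^ (1 / 6 : ℝ) ≤ L ^ (1 : ℝ) := Real.rpow_le_rpow_of_exponent_le hL1 (by norm_num)
      _ = L := Real.rpow_one L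
  have hℓL : ℓ ≤ L := hℓL6.trans hL16
  have hyx : (y : ℝ) ≤ x := by
    rw [← Real.exp_log hy0, ← Real.exp_log hx0]
    exact Real.exp_le_exp.mpr hℓL
  have hy3 : Real.log x ^ 3 ≤ y := le_trans (pow_le_pow_right₀ hL1 (by norm_num)) hy_ge
  -- ### the saddle point of `x`
  set α : ℝ := saddlePoint x y with hαdef
  set Φ : ℝ := saddlePhi₂ α y with hΦdef
  have hα35 : 3 / 5 ≤ α := h35 x y (hX_T.trans hxX) hy3 hyx
  have hα0 : 0 < α := by linarith
  have hα1 : α < 1 := hlt1 x y (hX_1.trans hxX) hy3 hyx hy6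
  have hΦU : Φ ≤ 3 * L * ℓ := hU x y (hX_U.trans hxX) hy3 hyx
  have hζ0 : 0 < smoothZeta α y := smoothZeta_pos hα0
  have hΦ0 : 0 < Φ := saddlePhi₂_pos hy2 hα0
  have hsqΦ : 0 < Real.sqrt Φ := Real.sqrt_pos.mpr hΦ0
  set ζt : ℝ := smoothZeta α y / Real.sqrt Φ with hζt
  have hζt0 : 0 < ζt := by positivity
  set B : ℝ := C₂' * ζt with hBdef
  have hB0 : 0 < B := by positivity
  -- the local bound in the form `Ψ(x') ≤ B x'^α`
  have hΨ : ∀ x' : ℝ, 1 ≤ x' → x' ≤ x →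
      (#(Nat.smoothNumbersUpTo ⌊x'⌋₊ (y + 1)) : ℝ) ≤ B * x' ^ α := by
    intro x' hx'1 hx'x
    have h := hM x y (hX_M.trans hxX) hy4 hy6 x' hx'1 hx'x
    rw [← hαdef] at h
    calc (#(Nat.smoothNumbersUpTo ⌊x'⌋₊ (y + 1)) : ℝ)
        ≤ C₂ * (x' ^ α * smoothZeta α y / Real.sqrt (saddlePhi₂ α y)) := h
      _ = C₂ * ζt * x' ^ α := by rw [hζt, hΦdef]; ring
      _ ≤ C₂' * ζt * x' ^ α := by gcongr
  -- `B ≥ 1 + log y`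
  have hBlog : 1 + Real.log y ≤ B := by
    -- `log ζt ≥ L^{5/6} - 31 - log L ≥ 1 + ℓ`
    have hlogζ : (L - 30) / ℓ ≤ Real.log (smoothZeta α y) := by
      have := log_sub_le_log_smoothZeta_saddlePoint hx1 hy2 (by rw [← hαdef]; exact hα35)
      rwa [← hαdef, ← hLdef, ← hℓdef] at this
    have h56 : L ^ (5 / 6 : ℝ) ≤ L / ℓ := by
      rw [le_div_iff₀ hℓ0]
      calc L ^ (5 / 6 : ℝ) * ℓ ≤ L ^ (5 / 6 : ℝ) * L ^ (1 / 6 : ℝ) := by gcongr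
        _ = L := by rw [← Real.rpow_add hL0]; norm_num
    have h30 : L / ℓ - 30 ≤ (L - 30) / ℓ := by
      rw [sub_div]; have : 30 / ℓ ≤ 30 := div_le_self (by norm_num) hℓ1; linarith
    have hb : Real.log (Real.sqrt Φ) ≤ 1 + Real.log L := by
      rw [Real.log_sqrt hΦ0.le]
      have h1 : Real.log Φ ≤ Real.log (3 * L * L) :=
        Real.log_le_log hΦ0 (hΦU.trans (mul_le_mul_of_nonneg_left hℓL (by positivity)))
      rw [Real.log_mul (by positivity) hL0.ne', Real.log_mul (by norm_num) hL0.ne'] at h1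
      have h3 : Real.log 3 ≤ 2 := by
        have := Real.log_le_sub_one_of_pos (by norm_num : (0 : ℝ) < 3); linarith
      linarith
    have hlogζt : L ^ (5 / 6 : ℝ) - 31 - Real.log L ≤ Real.log ζt := by
      rw [hζt, Real.log_div hζ0.ne' hsqΦ.ne']
      linarith
    -- numerics: `log L ≤ √L`, `2√L ≤ L^{5/6}/2`, `64 ≤ L^{5/6}`
    have hlogL : Real.log L ≤ L ^ (1 / 2 : ℝ) := by have := hY L hLY; linarith
    have hL13 : (4 : ℝ) ≤ L ^ (1 / 3 : ℝ) := by
      calc (4 : ℝ) = (64 : ℝ) ^ (1 / 3 : ℝ) := by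
            rw [show (64 : ℝ) = 4 ^ (3 : ℕ) by norm_num, ← Real.rpow_natCast,
              ← Real.rpow_mul (by norm_num)]; norm_num
        _ ≤ L ^ (1 / 3 : ℝ) := Real.rpow_le_rpow (by norm_num) hL64 (by norm_num)
    have hL56 : L ^ (5 / 6 : ℝ) = L ^ (1 / 2 : ℝ) * L ^ (1 / 3 : ℝ) := by
      rw [← Real.rpow_add hL0]; norm_num
    have hsqrtL : (16 : ℝ) ≤ L ^ (1 / 2 : ℝ) := by
      calc (16 : ℝ) = (256 : ℝ) ^ (1 / 2 : ℝ) := by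
            rw [show (256 : ℝ) = 16 ^ (2 : ℕ) by norm_num, ← Real.rpow_natCast,
              ← Real.rpow_mul (by norm_num)]; norm_num
        _ ≤ L ^ (1 / 2 : ℝ) := Real.rpow_le_rpow (by norm_num) hL256 (by norm_num)
    have hkey : 32 + 2 * Real.log L ≤ L ^ (5 / 6 : ℝ) := by
      rw [hL56]
      have h0 : 0 ≤ L ^ (1 / 2 : ℝ) := by positivity
      have h1 : 4 * L ^ (1 / 2 : ℝ) ≤ L ^ (1 / 2 : ℝ) * L ^ (1 / 3 : ℝ) := by nlinarith
      linarith
    -- `log (1 + log y) ≤ 1 + log L`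
    have hll : Real.log (1 + ℓ) ≤ 1 + Real.log L := by
      have h1 : 1 + ℓ ≤ 2 * L := by linarith
      have h2 : Real.log (1 + ℓ) ≤ Real.log (2 * L) := Real.log_le_log (by linarith) h1
      rw [Real.log_mul (by norm_num) hL0.ne'] at h2
      have h3 : Real.log 2 ≤ 1 := by have := Real.log_two_lt_d9; linarith
      linarith
    have hfin : Real.log (1 + ℓ) ≤ Real.log ζt := by linarith
    calc 1 + Real.log y = 1 + ℓ := by rw [hℓdef]
      _ ≤ ζt := by
          rw [← Real.exp_log (by linarith : 0 < 1 + ℓ), ← Real.exp_log hζt0]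
          exact Real.exp_le_exp.mpr hfin
      _ = 1 * ζt := (one_mul _).symm
      _ ≤ C₂' * ζt := mul_le_mul_of_nonneg_right hC₂'1 hζt0.le
  ------------------------------------------------------------------
  -- ### the parameters of the factorisation
  have hq1 : (1 : ℝ) ≤ q := by exact_mod_cast hq
  have hq0 : (0 : ℝ) < q := by linarith
  have hqy1 : (1 : ℝ) ≤ q * y := by nlinarith
  set W : ℝ := Z / (q * y) with hWdef
  have hZqy : q * y ≤ Z := hZ
  have hW1 : 1 ≤ W := by rw [hWdef, le_div_iff₀ (by positivity)]; linarith
  have hW0 : 0 < W := by linarith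
  have hZ0 : 0 < Z := by linarith
  have hZx : Z ≤ x := by linarith
  have hWZ : W ≤ Z := by rw [hWdef]; exact div_le_self hZ0.le hqy1
  have hWx : W ≤ x := hWZ.trans hZx
  have hWy : W * y = Z / q := by rw [hWdef]; field_simp
  have hZq : W * y ≤ x := by
    rw [hWy]; exact (div_le_self hZ0.le hq1).trans hZx
  set E := {n ∈ Finset.Ioc ⌊V⌋₊ ⌊V + Z⌋₊ | n ≡ c [MOD q] ∧ n ∈ Nat.smoothNumbers (y + 1)} with hE
  have hEmem : ∀ n ∈ E, V < n ∧ (n : ℝ) ≤ V + Z ∧ n ≡ c [MOD q] ∧ n ∈ Nat.smoothNumbers (y + 1) := by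
    intro n hn
    rw [hE, Finset.mem_filter, Finset.mem_Ioc] at hn
    exact ⟨Nat.lt_of_floor_lt hn.1.1, le_trans (by exact_mod_cast hn.1.2) (Nat.floor_le (by linarith)),
      hn.2.1, hn.2.2⟩
  -- ### (1) small `n ≤ W`
  set Es := E.filter (fun n : ℕ => ((n : ℝ)) ≤ W) with hEs
  set Eb := E.filter (fun n : ℕ => ¬ ((n : ℝ)) ≤ W) with hEb
  have hsplit : (E.card : ℝ) = Es.card + Eb.card := by
    rw [hEs, hEb]
    exact_mod_cast (Finset.card_filter_add_card_filter_not (s := E) (fun n : ℕ => ((n : ℝ)) ≤ W)).symm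
  have hEs_le : (Es.card : ℝ) ≤ B * W ^ α := by
    have hsub : Es ⊆ Nat.smoothNumbersUpTo ⌊W⌋₊ (y + 1) := by
      intro n hn
      rw [hEs, Finset.mem_filter] at hn
      obtain ⟨hnE, hnW⟩ := hn
      obtain ⟨-, -, -, hsm⟩ := hEmem n hnE
      rw [Nat.mem_smoothNumbersUpTo]
      exact ⟨Nat.le_floor hnW, hsm⟩
    exact le_trans (by exact_mod_cast Finset.card_le_card hsub) (hΨ W hW1 hWx)
  -- ### (2) large `n > W`: Friedlander's factorisation
  set Mset := (Finset.Ioc ⌊W⌋₊ ⌊W * y⌋₊).filter (· ∈ Nat.smoothNumbers (y + 1)) with hMset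
  have hMmem : ∀ m ∈ Mset, W < m ∧ (m : ℝ) ≤ W * y ∧ m ∈ Nat.smoothNumbers (y + 1) := by
    intro m hm
    rw [hMset, Finset.mem_filter, Finset.mem_Ioc] at hm
    exact ⟨Nat.lt_of_floor_lt hm.1.1, le_trans (by exact_mod_cast hm.1.2) (Nat.floor_le (by positivity)), hm.2⟩
  have hcover : ∀ n ∈ Eb, ∃ m ∈ Mset, m ∣ n := by
    intro n hn
    rw [hEb, Finset.mem_filter] at hn
    obtain ⟨hnE, hnW⟩ := hn
    push Not at hnW
    obtain ⟨-, -, -, hsm⟩ := hEmem n hnE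
    obtain ⟨m, hmn, hmW, hmWy⟩ := exists_divisor_mem_Ioc hW1 hsm hnW
    refine ⟨m, ?_, hmn⟩
    rw [hMset, Finset.mem_filter, Finset.mem_Ioc]
    have hm0 : m ≠ 0 := by
      rintro rfl; simp at hmW; linarith
    refine ⟨⟨(Nat.floor_lt hW0.le).mpr hmW, Nat.le_floor hmWy⟩, ?_⟩
    exact Nat.mem_smoothNumbers_of_dvd hsm hmn
  have hEb_le : (Eb.card : ℝ) ≤ ∑ m ∈ Mset, ((Eb.filter (fun n : ℕ => m ∣ n)).card : ℝ) :=
    card_le_sum_card_filter Eb Mset (fun m n : ℕ => m ∣ n) hcover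
  -- ### (3) the count for a fixed `m`
  have hper : ∀ m ∈ Mset, ((Eb.filter (fun n : ℕ => m ∣ n)).card : ℝ) ≤ 3 * Z / (m * q) := by
    intro m hm
    obtain ⟨hmW, hmWy, -⟩ := hMmem m hm
    have hm0r : (0 : ℝ) < m := by linarith
    have hm0 : 0 < m := by exact_mod_cast hm0r
    -- inject `n ↦ n / m` into `{n' ∈ (V/m, (V+Z)/m] : m n' ≡ c}`
    set T := {n' ∈ Finset.Ioc ⌊V / m⌋₊ ⌊(V + Z) / m⌋₊ | m * n' ≡ c [MOD q]} with hT
    have hinj : ((Eb.filter (fun n : ℕ => m ∣ n)).card : ℝ) ≤ T.card := by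
      have := Finset.card_le_card_of_injOn (fun n => n / m) (fun n hn => ?_) (fun n₁ hn₁ n₂ hn₂ heq => ?_)
        (s := Eb.filter (fun n : ℕ => m ∣ n)) (t := T)
      · exact_mod_cast this
      · rw [Finset.mem_coe, Finset.mem_filter] at hn
        obtain ⟨hnEb, hdvd⟩ := hn
        have hnE : n ∈ E := (Finset.mem_filter.mp hnEb).1
        obtain ⟨hnV, hnVZ, hmod, -⟩ := hEmem n hnE
        have hmul : m * (n / m) = n := Nat.mul_div_cancel' hdvd
        have hcast : ((n / m : ℕ) : ℝ) = (n : ℝ) / m := by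
          rw [Nat.cast_div hdvd (by exact_mod_cast hm0.ne')]
        rw [Finset.mem_coe, hT, Finset.mem_filter, Finset.mem_Ioc]
        refine ⟨⟨?_, ?_⟩, by rw [hmul]; exact hmod⟩
        · rw [Nat.floor_lt (by positivity), hcast]
          exact div_lt_div_of_pos_right hnV hm0r
        · apply Nat.le_floor; rw [hcast]
          exact div_le_div_of_nonneg_right hnVZ hm0r.le
      · have h1 : m ∣ n₁ := (Finset.mem_filter.mp (Finset.mem_coe.mp hn₁)).2
        have h2 : m ∣ n₂ := (Finset.mem_filter.mp (Finset.mem_coe.mp hn₂)).2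
        have := congrArg (fun k => m * k) heq
        simp only [Nat.mul_div_cancel' h1, Nat.mul_div_cancel' h2] at this
        exact this
    have hAB : ⌊V / m⌋₊ ≤ ⌊(V + Z) / m⌋₊ :=
      Nat.floor_le_floor (div_le_div_of_nonneg_right (by linarith) hm0r.le)
    have hT_le := card_Ioc_filter_mul_modEq_le hq hAB m c
    rw [← hT] at hT_le
    -- `⌊(V+Z)/m⌋ - ⌊V/m⌋ ≤ Z/m + 1`
    have hdiff : ((⌊(V + Z) / m⌋₊ : ℝ) - ⌊V / m⌋₊) ≤ Z / m + 1 := by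
      have h1 : (⌊(V + Z) / m⌋₊ : ℝ) ≤ (V + Z) / m := Nat.floor_le (by positivity)
      have h2 : V / m - 1 < ⌊V / m⌋₊ := by
        have := Nat.lt_floor_add_one (V / m); linarith
      have h3 : (V + Z) / m = V / m + Z / m := by rw [add_div]
      linarith
    have hZm : (q : ℝ) ≤ Z / m := by
      rw [le_div_iff₀ hm0r]
      calc (q : ℝ) * m ≤ q * (W * y) := by gcongr
        _ = Z := by rw [hWy]; field_simp
    have hZm1 : 1 ≤ Z / m := hq1.trans hZm
    -- if `gcd(m, q) ≠ 1` there are no solutions (`(c, q) = 1`)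
    by_cases hg : Nat.gcd m q = 1
    · rw [hg, Nat.cast_one, mul_one] at hT_le
      calc ((Eb.filter (fun n : ℕ => m ∣ n)).card : ℝ) ≤ T.card := hinj
        _ ≤ ((⌊(V + Z) / m⌋₊ : ℝ) - ⌊V / m⌋₊) / q + 1 := hT_le
        _ ≤ (Z / m + 1) / q + 1 := by gcongr
        _ ≤ (2 * (Z / m)) / q + (Z / m) / q := by
            have h1 : (Z / m + 1) / q ≤ (2 * (Z / m)) / q := by gcongr; linarith
            have h2 : (1 : ℝ) ≤ (Z / m) / q := by rw [le_div_iff₀ hq0]; linarith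
            linarith
        _ = 3 * Z / (m * q) := by field_simp; ring
    · have hTempty : T = ∅ := by
        rw [Finset.eq_empty_iff_forall_notMem]
        intro n' hn'
        rw [hT, Finset.mem_filter] at hn'
        have hmod := hn'.2
        -- `gcd(m,q) ∣ c`, hence `gcd(m,q) ∣ gcd(c,q) = 1`
        have h1 : Nat.gcd m q ∣ m * n' := (Nat.gcd_dvd_left m q).trans (Dvd.intro _ rfl)
        have h2 : Nat.gcd m q ∣ c := (Nat.ModEq.dvd_iff hmod (Nat.gcd_dvd_right m q)).mp h1
        have h3 : Nat.gcd m q ∣ Nat.gcd c q := Nat.dvd_gcd h2 (Nat.gcd_dvd_right m q)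
        rw [Nat.Coprime.gcd_eq_one hcq, Nat.dvd_one] at h3
        exact hg h3
      calc ((Eb.filter (fun n : ℕ => m ∣ n)).card : ℝ) ≤ T.card := hinj
        _ = 0 := by rw [hTempty]; simp
        _ ≤ 3 * Z / (m * q) := by positivity
  -- ### (4) the harmonic sum over `m`
  have hlog2 : 0 < Real.log 2 := Real.log_pos one_lt_two
  have hharm : ∑ m ∈ Mset, (1 / (m : ℝ)) ≤ 4 * B * (ℓ / Real.log 2 + 2) * W ^ (α - 1) := by
    have := sum_inv_smooth_Ioc_le (X := x) hy2 hα0 hα1.le hW0 hZq hBlog hΨ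
    rw [← hMset] at this
    exact this
  -- ### (7) assemble
  have hEb_bound : (Eb.card : ℝ) ≤ 3 * Z / q * (4 * B * (ℓ / Real.log 2 + 2) * W ^ (α - 1)) := by
    calc (Eb.card : ℝ) ≤ ∑ m ∈ Mset, ((Eb.filter (fun n : ℕ => m ∣ n)).card : ℝ) := hEb_le
      _ ≤ ∑ m ∈ Mset, 3 * Z / (m * q) := Finset.sum_le_sum hper
      _ = 3 * Z / q * ∑ m ∈ Mset, (1 / (m : ℝ)) := by
          rw [Finset.mul_sum]
          refine Finset.sum_congr rfl fun m hm => ?_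
          have : (0 : ℝ) < m := by linarith [(hMmem m hm).1]
          field_simp
      _ ≤ _ := mul_le_mul_of_nonneg_left hharm (by positivity)
  -- rewrite in terms of `Z/q` and `y`
  have hZq0 : 0 < Z / q := by positivity
  have hWpow : W ^ α = (Z / q) ^ α * (y : ℝ) ^ (-α) := by
    rw [hWdef, show Z / (q * y) = Z / q / y by rw [div_div], Real.div_rpow hZq0.le hy0.le,
      Real.rpow_neg hy0.le, div_eq_mul_inv]
  have hWpow' : Z / q * W ^ (α - 1) = (Z / q) ^ α * (y : ℝ) ^ (1 - α) := by
    rw [hWdef, show Z / (q * y) = Z / q / y by rw [div_div], Real.div_rpow hZq0.le hy0.le]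
    rw [Real.rpow_sub_one hZq0.ne', show (1 : ℝ) - α = -(α - 1) by ring, Real.rpow_neg hy0.le]
    field_simp
  have hyneg : (y : ℝ) ^ (-α) ≤ 1 := Real.rpow_le_one_of_one_le_of_nonpos hy1 (by linarith)
  have hyq : (1 : ℝ) ≤ (y : ℝ) ^ (1 - α) := Real.one_le_rpow hy1 (by linarith)
  have hℓ2 : ℓ / Real.log 2 + 2 ≤ 2 * ℓ := by
    rw [div_add' _ _ _ hlog2.ne', div_le_iff₀ hlog2]
    have := Real.log_two_gt_d9
    nlinarith
  set P : ℝ := (Z / q) ^ α * (y : ℝ) ^ (1 - α) with hP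
  have hP0 : 0 < P := by positivity
  have h1 : (Es.card : ℝ) ≤ B * P := by
    calc (Es.card : ℝ) ≤ B * W ^ α := hEs_le
      _ = B * ((Z / q) ^ α * (y : ℝ) ^ (-α)) := by rw [hWpow]
      _ ≤ B * ((Z / q) ^ α * 1) := by gcongr
      _ ≤ B * P := by
          rw [hP, mul_one]
          exact mul_le_mul_of_nonneg_left (le_mul_of_one_le_right (by positivity) hyq) hB0.le
  have h2 : (Eb.card : ℝ) ≤ 24 * ℓ * (B * P) := by
    calc (Eb.card : ℝ) ≤ 3 * Z / q * (4 * B * (ℓ / Real.log 2 + 2) * W ^ (α - 1)) := hEb_bound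
      _ = 12 * (ℓ / Real.log 2 + 2) * B * (Z / q * W ^ (α - 1)) := by ring
      _ = 12 * (ℓ / Real.log 2 + 2) * B * P := by rw [hWpow', hP]
      _ ≤ 12 * (2 * ℓ) * B * P := by gcongr
      _ = 24 * ℓ * (B * P) := by ring
  calc (E.card : ℝ) = Es.card + Eb.card := hsplit
    _ ≤ B * P + 24 * ℓ * (B * P) := add_le_add h1 h2
    _ ≤ ℓ * (B * P) + 24 * ℓ * (B * P) := by
        have hBP : B * P ≤ ℓ * (B * P) := le_mul_of_one_le_left (by positivity) hℓ1
        linarith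
    _ = 25 * C₂' * ℓ * P * ζt := by rw [hBdef]; ring
    _ = 25 * C₂' * Real.log y * (Z / q) ^ α * (y : ℝ) ^ (1 - α) *
          (smoothZeta α y / Real.sqrt Φ) := by rw [hP, hζt, hℓdef]; ring

/-- **Smooth numbers in a segment of an arithmetic progression, any residue class** (Harper's
Smooth Numbers Result 3 with the reduction `h = (c, q)`, `n = h n''`, `n'' ≡ c/h (mod q/h)`):
for `x ≥ x₀`, `(log x)^4 ≤ y`, `log y ≤ (log x)^{1/6}`, `q ≥ 1`, ANY `c`, `0 ≤ V`, `qy ≤ Z`,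
`V + Z ≤ x`:
`#{n ∈ (V, V+Z] : n ≡ c (mod q), n ∈ S(y)} ≤ C log y · (Z/q)^α y^{1−α} ζ(α,y)/√φ₂(α,y)`.
[cite: Harper2016, §2.1 (Smooth Numbers Result 3) and §3 ("if we let `h = (a,q)` …")] -/
theorem card_smooth_segment_modEq_le :
    ∃ C x₀ : ℝ, 0 < C ∧ ∀ (x : ℝ) (y : ℕ), x₀ ≤ x → Real.log x ^ 4 ≤ y →
      Real.log y ≤ Real.log x ^ (1 / 6 : ℝ) → ∀ (q : ℕ), 0 < q → ∀ (c : ℕ) (V Z : ℝ), 0 ≤ V →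
        (q : ℝ) * y ≤ Z → V + Z ≤ x →
        (#{n ∈ Finset.Ioc ⌊V⌋₊ ⌊V + Z⌋₊ | n ≡ c [MOD q] ∧ n ∈ Nat.smoothNumbers (y + 1)} : ℝ) ≤
          C * Real.log y * (Z / q) ^ saddlePoint x y * (y : ℝ) ^ (1 - saddlePoint x y) *
            (smoothZeta (saddlePoint x y) y / Real.sqrt (saddlePhi₂ (saddlePoint x y) y)) := by
  classical
  obtain ⟨C, x₀, hC, hmain⟩ := card_smooth_segment_modEq_le_of_coprime
  refine ⟨C, x₀, hC, fun x y hx hy4 hy6 q hq c V Z hV hZ hVZ => ?_⟩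
  set h := Nat.gcd c q with hh
  have hh0 : 0 < h := Nat.gcd_pos_of_pos_right c hq
  have hh0r : (0 : ℝ) < h := by exact_mod_cast hh0
  have hhq : h ∣ q := Nat.gcd_dvd_right c q
  have hhc : h ∣ c := Nat.gcd_dvd_left c q
  set q' := q / h with hq'
  set c' := c / h with hc'
  have hq'0 : 0 < q' := Nat.div_pos (Nat.le_of_dvd hq hhq) hh0
  have hcop : Nat.Coprime c' q' := by
    rw [hc', hq', hh]; exact Nat.coprime_div_gcd_div_gcd hh0
  have hq'r : (q' : ℝ) = q / h := by rw [hq', Nat.cast_div hhq hh0r.ne']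
  have hqh : (q : ℝ) = h * q' := by rw [hq'r]; field_simp
  -- apply the coprime case to `(q', c', V/h, Z/h)`
  have hV' : 0 ≤ V / h := div_nonneg hV hh0r.le
  have hZ' : (q' : ℝ) * y ≤ Z / h := by
    rw [le_div_iff₀ hh0r]
    calc (q' : ℝ) * y * h = (h * q') * y := by ring
      _ = q * y := by rw [← hqh]
      _ ≤ Z := hZ
  have hVZ' : V / h + Z / h ≤ x := by
    rw [← add_div]
    have h1 : (1 : ℝ) ≤ h := by exact_mod_cast hh0
    have hVZ0 : 0 ≤ V + Z := by
      have : (0 : ℝ) ≤ Z := le_trans (by positivity) hZ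
      linarith
    exact (div_le_self hVZ0 h1).trans hVZ
  have key := hmain x y hx hy4 hy6 q' hq'0 c' hcop (V / h) (Z / h) hV' hZ' hVZ'
  have hZq : Z / h / q' = Z / q := by rw [hq'r, div_div, mul_div_cancel₀ _ hh0r.ne']
  rw [hZq] at key
  refine le_trans ?_ key
  -- inject `n ↦ n / h`
  have hinj := Finset.card_le_card_of_injOn (fun n : ℕ => n / h)
    (s := {n ∈ Finset.Ioc ⌊V⌋₊ ⌊V + Z⌋₊ | n ≡ c [MOD q] ∧ n ∈ Nat.smoothNumbers (y + 1)})
    (t := {n ∈ Finset.Ioc ⌊V / h⌋₊ ⌊V / h + Z / h⌋₊ | n ≡ c' [MOD q'] ∧ n ∈ Nat.smoothNumbers (y + 1)})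
    (fun n hn => ?_) (fun n₁ hn₁ n₂ hn₂ heq => ?_)
  · exact_mod_cast hinj
  · rw [Finset.mem_coe, Finset.mem_filter, Finset.mem_Ioc] at hn
    obtain ⟨⟨hnV, hnVZ⟩, hmod, hsm⟩ := hn
    -- `h ∣ n`
    have hhn : h ∣ n := by
      have h1 : n ≡ c [MOD h] := Nat.ModEq.of_dvd hhq hmod
      exact (Nat.modEq_zero_iff_dvd.mp (h1.trans (Nat.modEq_zero_iff_dvd.mpr hhc)))
    have hncast : ((n / h : ℕ) : ℝ) = (n : ℝ) / h := Nat.cast_div hhn hh0r.ne'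
    have hnVr : V < n := Nat.lt_of_floor_lt hnV
    have hnVZr : (n : ℝ) ≤ V + Z := by
      have hZ0 : (0 : ℝ) ≤ Z := le_trans (by positivity) hZ
      have := Nat.floor_le (show 0 ≤ V + Z by linarith)
      exact le_trans (by exact_mod_cast hnVZ) this
    rw [Finset.mem_coe, Finset.mem_filter, Finset.mem_Ioc]
    refine ⟨⟨?_, ?_⟩, ?_, Nat.mem_smoothNumbers_of_dvd hsm (Nat.div_dvd_of_dvd hhn)⟩
    · rw [Nat.floor_lt hV', hncast]; exact div_lt_div_of_pos_right hnVr hh0r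
    · apply Nat.le_floor; rw [hncast, ← add_div]; exact div_le_div_of_nonneg_right hnVZr hh0r.le
    · -- `h (n/h) ≡ h (c/h) (mod q)` and cancel `h`
      have h1 : h * (n / h) ≡ h * (c / h) [MOD q] := by
        rw [Nat.mul_div_cancel' hhn, Nat.mul_div_cancel' hhc]; exact hmod
      have h2 := Nat.ModEq.cancel_left_div_gcd hq h1
      rwa [Nat.gcd_comm, show Nat.gcd h q = h from Nat.gcd_eq_left hhq] at h2
  · have h1 : h ∣ n₁ := by
      have hm := (Finset.mem_filter.mp (Finset.mem_coe.mp hn₁)).2.1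
      have := Nat.ModEq.of_dvd hhq hm
      exact Nat.modEq_zero_iff_dvd.mp (this.trans (Nat.modEq_zero_iff_dvd.mpr hhc))
    have h2 : h ∣ n₂ := by
      have hm := (Finset.mem_filter.mp (Finset.mem_coe.mp hn₂)).2.1
      have := Nat.ModEq.of_dvd hhq hm
      exact Nat.modEq_zero_iff_dvd.mp (this.trans (Nat.modEq_zero_iff_dvd.mpr hhc))
    have := congrArg (fun k => h * k) heq
    simpa only [Nat.mul_div_cancel' h1, Nat.mul_div_cancel' h2] using this

end Literature.NumberTheory.Sieve

end
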